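import Summits.NavierStokesRegularity.NavierStokesRegularity.Theorems.StrainClockLocalDefs
import HarnessLib

/-!
# StrainClockBudgetedDefs — door family S41 «BudgetedClock»: texts of record (§1)

P0-41 part 1 of 3: §1 (doors `BudgetedParityDoor` (D5), `BudgetedDriftSmoothing` (D6)) of nsreg-p1 g32's `r39/Sketch42.lean`
sha16 7255af488b752fb6 (ROUND-39 S41 «BudgetedClock», memo v1.1 2ec8562e2824807f), every declaration byte-identical, order
preserved; imports ONLY the landed `…Theorems.StrainClockLocalDefs` (p667521) as the sketch does; cut prepared by ns-s29-p2 g5 per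
memo §8 (file 2 of the memo split in two for the 400-line cap: `…Compositions` = §2 engine, `…Closers` = §3),
`--supports stmt-NavierStokesRegularity-0056 --as helper`, `--kind definition`.  The sketch's module docstring follows verbatim.

HONEST FRAME: door family S41 «BudgetedClock» = budgeted strain-clock CRITERIA (conditional statements about HYPOTHETICAL blow-up
profiles; the content is the quantitative BKM-shaped residual); items 0056 `NoTypeII`, 10661 and NS regularity are NOT proved;
nothing here is a route or a summit statement.
-/

/-!
# Sketch42 — door family S41 «BudgetedClock» (nsreg-p1 g32, ROUND-39): texts of record + kernel-checked compositions

The strain clocks of S38–S40 all ask a SIGN at the charged maximisers — total feed `≤ c q²` (`c < 1`, D1–D3, A0, C3)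
or `≤ q²` (parity, D4) — and their blow-up residual is correspondingly QUALITATIVE («super-parity on the charge set at
times accumulating at `T`»). S41 gives the clock a BUDGET: the hypothesis may be violated, at a RATE `b(t) ≥ 0` per
unit strain — total feed `≤ c q² + b(t)·q` — provided the rate has a bounded primitive `Φ` (`Φ′ = b`, `0 ≤ Φ ≤ β`) up
to `T`. The barrier is multiplied by `e^{Φ(t)}` (for the Riccati barrier `a + 1/D` of S40 this works because
`e^{2Φ} ≥ e^{Φ}`; for the constant barrier of D4 it is exact, `B′ = bB`), and every conclusion survives with the factor
`e^{β}`. The residual becomes QUANTITATIVE and BKM-shaped: blow-up at `T` forces the excess RATE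
`b⋆(t) = sup {(H + drift − c q²)₊ / q : charged maximisers at time t}` to be NON-INTEGRABLE at `T`.

(D5) «BudgetedParityDoor» — forward, S38's Sobolev frame, parity up to a budgeted excess at the charged `δ`-almost
maximisers ⇒ extension past `T` (`HasSobolevExtensionPast`). D4 = the zero-budget case (`parityRatio_of_budgeted`).
(D6) «BudgetedDriftSmoothing» — forward, S33's blow-up-PERMITTING velocity-free frame (D1's), total feed (strain feed +
drift across the resolution) `≤ c q² + b(t) q` at the charged exact `ε`-penalised maximisers above the level `ℓ` ⇒
`(1+ε|x|²)⁻¹⟪∇u(t,x)e,e⟫ ≤ e^{β}(ℓ + 6νε/κ + 1/(κ(t−t₀)))` on `(t₀,T)`. D1 = the zero-budget case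
(`driftCharged_of_budgeted`).

* imports ONLY landed files: `…Theorems.StrainClockLocalDefs` (P0-39 part 1, p667521, LIVE: `IsStrainPenalisedArgmax`,
  plate text E2_S^w `StrainThresholdWeightedOn`; it re-exports P0-38's Closers, p664793 `strainThresholdWeighted` and
  p660752 `strainGrowthWeighted`) + `HarnessLib`. Nothing is re-declared.
* §1 texts D5, D6 · §2 engine `budgetedSlab_bound` (S40's level-charged weighted one-slab bound with the exponential
  factor) · §3 compositions + closers (BOTH DOORS CLOSED, the plate E2_S^w passed BY NAME as `strainThresholdWeighted`;
  `lean check --axioms`: propext / Classical.choice / Quot.sound) + the zero-budget reductions to D4 / D1.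

HONEST LABEL: conditional criteria; variants of D4 / D1 (same engine: E1_S♭ p660752, E2_S^w p664793, E2_S♭-lin p658095)
whose content is the sharper, quantitative RESIDUAL. WHAT THIS IS NOT: item 0056 `NoTypeII`, item 10661
`TypeIliouvilleL` and NS regularity are NOT proved; no Literature fact is a hypothesis; BKM is neither used nor reproved
(the analogy is in the shape of the residual only); nothing here is a route or a summit statement
(`--supports stmt-NavierStokesRegularity-0056 --as helper`, Theorems-only landings by the S-lane).
-/

noncomputable section

open MeasureTheory Set Function Filter Metric Real InnerProductSpace
open _root_.Topology
open scoped ENNReal NNReal RealInnerProductSpace ContDiff Laplacian Interval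
open Literature.Analysis Literature.Analysis.FluidPDE
open Literature.Analysis.FluidPDE.VorticityDirectionDynamics

set_option linter.dupNamespace false

namespace Summit.NavierStokesRegularity.NavierStokesRegularity.Theorems.StrainDoors

open Summit.NavierStokesRegularity.NavierStokesRegularity.Theorems.ArgmaxDoors

-- nested operator types (second derivatives)
set_option maxSynthPendingDepth 3


/-! ## §1 Texts D5, D6 -/

/-- door D5 «BudgetedParityDoor» (crux-grade text; forward, S38's Sobolev frame). Classical unforced solution on
`[0,T)`, `H¹ ∩ Ḣ^m`-bounded on every `[0,T'']`, `T'' < T`; a BUDGET `Φ` on `[t₀,T)` with `Φ(t₀) = 0`, `0 ≤ Φ ≤ β`,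
`Φ′ = b`. IF at every `δ`-almost strain maximiser charged above the level `l₀` the strain feed obeys PARITY UP TO THE
BUDGETED EXCESS `H ≤ q² + b(t)·q`, THEN the solution extends past `T` in the Sobolev class. Blow-up at `T` therefore
needs a NON-INTEGRABLE super-parity excess rate on the charge set. -/
def BudgetedParityDoor : Prop :=
  ∀ (ν T t₀ l₀ δ β : ℝ) (Φ b : ℝ → ℝ), 0 < ν → 0 ≤ t₀ → t₀ < T → 0 ≤ l₀ → 0 < δ → δ < 1 →
    Φ t₀ = 0 → (∀ t ∈ Ico t₀ T, 0 ≤ Φ t ∧ Φ t ≤ β ∧ HasDerivAt Φ (b t) t) →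
    ∀ (u : ℝ → (EuclideanSpace ℝ (Fin 3)) → (EuclideanSpace ℝ (Fin 3)))
      (p : ℝ → (EuclideanSpace ℝ (Fin 3)) → ℝ),
      IsClassicalNSSolutionOn (Ico 0 T) ν 0 u p →
      (∀ T'' < T, HasBoundedSobolevNormsOn (Icc 0 T'') u) →
      (∀ t ∈ Ico t₀ T, ∀ (x e : EuclideanSpace ℝ (Fin 3)), IsStrainAlmostArgmax δ u t x e →
        l₀ < strainQuad u t x e →
        strainFeed u p t x e ≤ strainQuad u t x e ^ 2 + b t * strainQuad u t x e) →
      HasSobolevExtensionPast ν u T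

/-- door D6 «BudgetedDriftSmoothing» (crux-grade text; forward, S33's blow-up-permitting velocity-free frame = D1's).
Classical unforced solution on `[0,T)`, `∇u` bounded on every `[t₀,T'] × ℝ³`, `T' < T` (NO velocity bound, nothing at
`T`); a BUDGET `Φ` on `[t₀,T)` with `0 ≤ Φ ≤ β`, `Φ′ = b`. IF at every exact `ε`-penalised strain maximiser `(x̄,ē)`,
`t ∈ [t₀,T)`, charged above the level `ℓ`, the TOTAL feed obeys `H + √ε‖u(x̄)‖q ≤ c q² + b(t)·q` (`c < 1`,
`κ = 1 − c`), THEN `(1+ε‖x‖²)⁻¹⟪∇u(t,x)e,e⟫ ≤ e^{β}(ℓ + 6νε/κ + 1/(κ(t−t₀)))` for all `t ∈ (t₀,T)`, `x`, unit `e`. -/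
def BudgetedDriftSmoothing : Prop :=
  ∀ (ν T t₀ ε ℓ c β : ℝ) (Φ b : ℝ → ℝ), 0 < ν → 0 ≤ t₀ → t₀ < T → 0 < ε → 0 ≤ ℓ → c < 1 →
    (∀ t ∈ Ico t₀ T, 0 ≤ Φ t ∧ Φ t ≤ β ∧ HasDerivAt Φ (b t) t) →
    ∀ (u : ℝ → (EuclideanSpace ℝ (Fin 3)) → (EuclideanSpace ℝ (Fin 3)))
      (p : ℝ → (EuclideanSpace ℝ (Fin 3)) → ℝ),
      IsClassicalNSSolutionOn (Ico 0 T) ν 0 u p →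
      (∀ T' : ℝ, T' < T → ∃ K : ℝ, ∀ t ∈ Icc t₀ T', ∀ x : EuclideanSpace ℝ (Fin 3), ‖fderiv ℝ (u t) x‖ ≤ K) →
      (∀ t ∈ Ico t₀ T, ∀ (x e : EuclideanSpace ℝ (Fin 3)), IsStrainPenalisedArgmax ε u t x e →
        ℓ < (1 + ε * ‖x‖ ^ 2)⁻¹ * strainQuad u t x e →
        strainFeed u p t x e + Real.sqrt ε * ‖u t x‖ * strainQuad u t x e ≤
          c * strainQuad u t x e ^ 2 + b t * strainQuad u t x e) →
      ∀ t ∈ Ioo t₀ T, ∀ (x e : EuclideanSpace ℝ (Fin 3)), ‖e‖ = 1 →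
        (1 + ε * ‖x‖ ^ 2)⁻¹ * strainQuad u t x e ≤
          Real.exp β * (ℓ + 6 * ν * ε / (1 - c) + 1 / ((1 - c) * (t - t₀)))


end Summit.NavierStokesRegularity.NavierStokesRegularity.Theorems.StrainDoors

end
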